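import Literature.NumberTheory.LFunctions.AutomaticSequencePowTransducer3
import Literature.NumberTheory.LFunctions.AutomaticSequenceTransducerArith7
import HarnessLib

/-!
# The transducer of the power automaton, IV: `k₀ = 1` for the `p`-th power when `d(A) k₀(A) ∣ p` (Müllner 2017, Prop. 2.25; proved)

Everything in this file is PROVED. Completing the group half of Prop. 2.25 of C. Müllner,
*Automatic sequences fulfill the Sarnak conjecture* (Duke Math. J. 166 (2017)): for the power
automaton `digitRestrict (k^p) (powδ k p δ)` (base `K = k^p`),

* `wordVal_powK` — `[W]_K = [blocks of W]_k`;
* `MinImage.pathVals_powK_one`, `diffGcd_powK_one`, `limitDiffGcd_powK_zero` — the numbers of the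
  identity paths, their difference-gcds and the stable value `d(q,q)` on the class `0` agree with
  those of `δ` (at `p` times the length);
* `transducerDPrime_powK_dvd` — `d'(A^{(p)}) ∣ d'(A)` (in fact they are equal; with Lemma 2.18);
* `s0Slope_unique`, `transducerK0_nsmul_s0Slope` — `k₀(A) • a = 0` for the common slope `a`;
* **`transducerK0_powK_eq_one`** — if `d(A) ∣ p` and `d(A) k₀(A) ∣ p` then `k₀(A^{(p)}) = 1`:
  the residues of the identity loops of the power transducer vanish, since a `K`-loop of length
  `ℓ` is a `k`-loop of length `pℓ = (pℓ/d) d` with residue `(pℓ/d) • a = 0`.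

Together with `transducerPeriod_powK_eq_one` (`AutomaticSequencePowTransducer3.lean`) this is
"`d(A_i) = k₀(A_i) = 1`" of Prop. 2.25 for a strongly connected automaton and `p` a multiple of
`d(A) k₀(A)`; the final-component bookkeeping of Prop. 2.25 (one `p` for all components, via the
lcm) is left to the user.

## References
* C. Müllner, Duke Math. J. 166 (2017), Prop. 2.25 (proof), Lemma 2.18. [Mullner2017]
-/

noncomputable section

open Finset

namespace Literature.NumberTheory.LFunctions

/-- `[W]_{k^p} = [blocks of W]_k`. [folklore] -/
theorem wordVal_powK {k p : ℕ} (hk : 1 < k) {W : List ℕ} (hW : ∀ D ∈ W, D < k ^ p) :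
    wordVal (k ^ p) W = wordVal k (W.map (msbBlock k p)).flatten := by
  induction W with
  | nil => simp [wordVal]
  | cons D W ih =>
    have hW' : ∀ x ∈ W, x < k ^ p := fun x hx => hW x (by simp [hx])
    rw [show D :: W = [D] ++ W from rfl, wordVal_append, List.map_append, List.flatten_append,
      wordVal_append, ih hW', length_flatten_map_msbBlock hk hW', pow_mul]
    congr 2
    · simp [wordVal, ofDigits_reverse_msbBlock]

namespace MinImage

variable {σ : Type*} [Fintype σ] [DecidableEq σ] {k p : ℕ}

/-- **Numbers of identity paths agree**: `pathVals` of the power transducer for the output `id`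
and length `L` = `pathVals` of `δ` for `id` and length `pL`. [cite: Mullner2017, Prop. 2.25 (proof)] -/
theorem pathVals_powK_one (hk : 2 ≤ k) (hp : 0 < p) (δ : σ → ℕ → σ)
    (htriv : ∀ q d, k ≤ d → δ q d = q) (M M' : MinImage (digitRestrict (k ^ p) (powδ k p δ)))
    (L : ℕ) :
    M.pathVals (k ^ p) M' 1 L =
      (minImageEquivPow hk hp δ htriv M).pathVals k (minImageEquivPow hk hp δ htriv M') 1 (p * L) := by
  have hk1 : 1 < k := hk
  set e := minImageEquivPow hk hp δ htriv with he
  ext x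
  constructor
  · rintro ⟨W, hWd, hWl, hWn, hWT, rfl⟩
    refine ⟨(W.map (msbBlock k p)).flatten, digits_flatten_map_msbBlock hk1 W,
      by rw [length_flatten_map_msbBlock hk1 hWd, hWl], ?_, ?_, (wordVal_powK hk1 hWd).symm⟩
    · rw [← minImageEquivPow_next hk hp δ htriv M hWd, hWn]
    · exact (T_powK_eq_one_iff hk hp δ htriv M hWd).1 hWT
  · rintro ⟨w, hwd, hwl, hwn, hwT, rfl⟩
    obtain ⟨W, hWd, rfl⟩ := exists_blocks_of_length_dvd hk1 hp _ w rfl hwd (hwl ▸ dvd_mul_right p L)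
    have hWl : W.length = L := by
      rw [length_flatten_map_msbBlock hk1 hWd] at hwl
      exact Nat.eq_of_mul_eq_mul_left hp hwl
    refine ⟨W, hWd, hWl, ?_, (T_powK_eq_one_iff hk hp δ htriv M hWd).2 hwT, wordVal_powK hk1 hWd⟩
    apply (minImageEquivPow hk hp δ htriv).injective
    rw [minImageEquivPow_next hk hp δ htriv M hWd, hwn]

/-- **Difference-gcds of identity paths agree.** [cite: Mullner2017, Prop. 2.25 (proof)] -/
theorem diffGcd_powK_one (hk : 2 ≤ k) (hp : 0 < p) (δ : σ → ℕ → σ)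
    (htriv : ∀ q d, k ≤ d → δ q d = q) (M M' : MinImage (digitRestrict (k ^ p) (powδ k p δ)))
    (L : ℕ) :
    M.diffGcd (k ^ p) M' 1 L =
      (minImageEquivPow hk hp δ htriv M).diffGcd k (minImageEquivPow hk hp δ htriv M') 1 (p * L) := by
  rw [diffGcd, diffGcd, pathVals_powK_one hk hp δ htriv M M' L]

/-- **The stable values `d(q, q)` on the class `0` agree** (when `d(A) ∣ p`, so that
`d(A^{(p)}) = 1`; loops, so that the identity output lies in the class). [cite: Mullner2017, Prop. 2.25 (proof)] -/
theorem limitDiffGcd_powK_zero (hk : 2 ≤ k) (hp : 0 < p) (δ : σ → ℕ → σ)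
    (htriv : ∀ q d, k ≤ d → δ q d = q) (hK : 2 ≤ k ^ p) (hdp : transducerPeriod k δ ∣ p)
    (M : MinImage (digitRestrict (k ^ p) (powδ k p δ))) :
    M.limitDiffGcd hK (digitRestrict_trivial (k ^ p) (powδ k p δ)) M 0 =
      (minImageEquivPow hk hp δ htriv M).limitDiffGcd hk htriv (minImageEquivPow hk hp δ htriv M) 0 := by
  have hk0 : 0 < k := by omega
  have hK0 : 0 < k ^ p := by omega
  haveI : NeZero (transducerPeriod (k ^ p) (digitRestrict (k ^ p) (powδ k p δ))) :=
    ⟨(transducerPeriod_pos hK0 (digitRestrict_trivial (k ^ p) (powδ k p δ))).ne'⟩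
  haveI : NeZero (transducerPeriod k δ) := ⟨(transducerPeriod_pos hk0 htriv).ne'⟩
  obtain ⟨m₁, hm₁⟩ := M.exists_forall_diffGcd_eq_limitDiffGcd hK (digitRestrict_trivial (k ^ p) (powδ k p δ)) M 0
  obtain ⟨m₂, hm₂⟩ := (minImageEquivPow hk hp δ htriv M).exists_forall_diffGcd_eq_limitDiffGcd hk htriv
    (minImageEquivPow hk hp δ htriv M) 0
  obtain ⟨c, hc⟩ := hdp
  have hcpos : 0 < c := by
    rcases Nat.eq_zero_or_pos c with rfl | h
    · rw [mul_zero] at hc; omega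
    · exact h
  have h1K : (1 : Equiv.Perm (Fin (minRank (digitRestrict (k ^ p) (powδ k p δ))))) ∈ M.pathOutputs (k ^ p) M 0 :=
    mem_pathOutputs.2 ⟨[], by simp, by simp, M.next_nil, M.T_nil⟩
  have h1k : (1 : Equiv.Perm (Fin (minRank δ))) ∈
      (minImageEquivPow hk hp δ htriv M).pathOutputs k (minImageEquivPow hk hp δ htriv M) 0 :=
    mem_pathOutputs.2 ⟨[], by simp, by simp, (minImageEquivPow hk hp δ htriv M).next_nil,
      (minImageEquivPow hk hp δ htriv M).T_nil⟩
  set N := max m₁ m₂ + 1 with hN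
  have e1 := hm₁ 1 h1K N (by omega)
  have e2 := hm₂ 1 h1k (c * N * transducerPeriod (k ^ p) (digitRestrict (k ^ p) (powδ k p δ)))
    (le_trans (by omega : m₂ ≤ N) (le_trans (Nat.le_mul_of_pos_left N hcpos)
      (Nat.le_mul_of_pos_right _ (transducerPeriod_pos hK0 (digitRestrict_trivial (k ^ p) (powδ k p δ))))))
  rw [ZMod.val_zero, zero_add] at e1 e2
  rw [← e1, ← e2, diffGcd_powK_one hk hp δ htriv M M,
    show p * (N * transducerPeriod (k ^ p) (digitRestrict (k ^ p) (powδ k p δ))) =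
      c * N * transducerPeriod (k ^ p) (digitRestrict (k ^ p) (powδ k p δ)) * transducerPeriod k δ by rw [hc]; ring]

end MinImage

section K0Pow

variable {σ : Type*} [Fintype σ] [DecidableEq σ] {k p : ℕ}

/-- **`d'(A^{(p)}) ∣ d'(A)`** when `d(A) ∣ p` (with Lemma 2.18 for `A`; in fact equality holds).
[cite: Mullner2017, Prop. 2.25 (proof)] -/
theorem transducerDPrime_powK_dvd (hk : 2 ≤ k) (hp : 0 < p) (δ : σ → ℕ → σ)
    (htriv : ∀ q d, k ≤ d → δ q d = q) (hK : 2 ≤ k ^ p) (hdp : transducerPeriod k δ ∣ p) :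
    transducerDPrime hK (digitRestrict (k ^ p) (powδ k p δ)) (digitRestrict_trivial (k ^ p) (powδ k p δ)) ∣ transducerDPrime hk δ htriv := by
  have hk0 : 0 < k := by omega
  have hK0 : 0 < k ^ p := by omega
  set htrivK := digitRestrict_trivial (k ^ p) (powδ k p δ)
  set M := transducerBase (digitRestrict (k ^ p) (powδ k p δ)) with hM
  set e := minImageEquivPow hk hp δ htriv with he
  -- `d'_K = gcd(D, K^{d_K} - 1)` with `D = d(eM, eM)` on the class 0; `d' = gcd(D, k^d - 1)`
  have hDK : transducerDPrime hK (digitRestrict (k ^ p) (powδ k p δ)) htrivK =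
      Nat.gcd ((e M).limitDiffGcd hk htriv (e M) 0) ((k ^ p) ^ transducerPeriod (k ^ p) (digitRestrict (k ^ p) (powδ k p δ)) - 1) := by
    rw [transducerDPrime, MinImage.dPrime, ← hM, MinImage.limitDiffGcd_powK_zero hk hp δ htriv hK hdp M]
  have hD : transducerDPrime hk δ htriv =
      Nat.gcd ((e M).limitDiffGcd hk htriv (e M) 0) (k ^ transducerPeriod k δ - 1) := by
    rw [← (e M).dPrime_eq_transducerDPrime hk htriv (e M) 0, MinImage.dPrime]
  obtain ⟨ℓ₀, hℓ₀⟩ := MinImage.exists_limitDiffGcd_dvd hk htriv (δ := δ)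
  have hdvd1 : transducerDPrime hK (digitRestrict (k ^ p) (powδ k p δ)) htrivK ∣ k ^ ℓ₀ * (k ^ transducerPeriod k δ - 1) := by
    rw [hDK]; exact (Nat.gcd_dvd_left _ _).trans (hℓ₀ (e M) (e M) 0)
  have hcop : Nat.Coprime (k ^ ℓ₀) (transducerDPrime hK (digitRestrict (k ^ p) (powδ k p δ)) htrivK) := by
    have h1 : transducerDPrime hK (digitRestrict (k ^ p) (powδ k p δ)) htrivK ∣ k ^ (p * transducerPeriod (k ^ p) (digitRestrict (k ^ p) (powδ k p δ))) - 1 := by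
      rw [pow_mul]; exact transducerDPrime_dvd hK (digitRestrict (k ^ p) (powδ k p δ)) htrivK
    exact Nat.Coprime.coprime_dvd_right h1
      (coprime_pow_pow_sub_one hk0 ℓ₀ _ (Nat.mul_pos hp (transducerPeriod_pos hK0 htrivK)))
  have hdvd2 : transducerDPrime hK (digitRestrict (k ^ p) (powδ k p δ)) htrivK ∣ k ^ transducerPeriod k δ - 1 :=
    hcop.symm.dvd_of_dvd_mul_left hdvd1
  rw [hD]
  exact Nat.dvd_gcd (by rw [hDK]; exact Nat.gcd_dvd_left _ _) hdvd2

/-- **The common slope is unique**: any `a` with `s^{MM}(id, ℓd) = ℓ • a` for large `ℓ` equals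
`s0Slope`. [folklore] -/
theorem MinImage.s0Slope_unique (hk : 2 ≤ k) {δ : σ → ℕ → σ} (htriv : ∀ q d, k ≤ d → δ q d = q)
    {M : MinImage δ} {m : ℕ} {a : ZMod (transducerDPrime hk δ htriv)}
    (h : ∀ ℓ : ℕ, m ≤ ℓ → M.sVal hk htriv M 1 (ℓ * transducerPeriod k δ) = ℓ • a) :
    a = MinImage.s0Slope hk htriv (δ := δ) :=
  MinImage.sVal_one_slope_eq hk htriv h ((MinImage.s0_spec hk htriv (δ := δ)).2.2 M)

/-- **`k₀(A) • a = 0`** for the common slope `a = s0Slope`. [cite: Mullner2017, Lemma 2.21] -/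
theorem transducerK0_nsmul_s0Slope (hk : 2 ≤ k) (δ : σ → ℕ → σ) (htriv : ∀ q d, k ≤ d → δ q d = q) :
    transducerK0 hk δ htriv • MinImage.s0Slope hk htriv (δ := δ) = 0 := by
  have h := (MinImage.exists_common_slope hk htriv (δ := δ)).choose_spec.choose_spec
  rw [← MinImage.s0Slope_unique hk htriv (M := transducerBase δ) (fun ℓ hℓ => h (transducerBase δ) ℓ hℓ),
    transducerK0]
  exact addOrderOf_nsmul_eq_zero _

/-- **Müllner 2017, Prop. 2.25 (`k₀ = 1` for the power automaton)**: if `d(A) ∣ p` and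
`d(A) k₀(A) ∣ p` (`p ≥ 1`), then the naturally induced transducer of the `p`-th power automaton
(base `k^p`, letters `≥ k^p` trivial) has `k₀ = 1`. [cite: Mullner2017, Prop. 2.25] -/
theorem transducerK0_powK_eq_one (hk : 2 ≤ k) (hp : 0 < p) (δ : σ → ℕ → σ)
    (htriv : ∀ q d, k ≤ d → δ q d = q) (hK : 2 ≤ k ^ p) (hdp : transducerPeriod k δ ∣ p)
    (hkp : transducerPeriod k δ * transducerK0 hk δ htriv ∣ p) :
    transducerK0 hK (digitRestrict (k ^ p) (powδ k p δ)) (digitRestrict_trivial (k ^ p) (powδ k p δ)) = 1 := by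
  have hk0 : 0 < k := by omega
  have hk1 : 1 < k := hk
  have hK0 : 0 < k ^ p := by omega
  set htrivK := digitRestrict_trivial (k ^ p) (powδ k p δ)
  haveI : NeZero (transducerPeriod (k ^ p) (digitRestrict (k ^ p) (powδ k p δ))) := ⟨(transducerPeriod_pos hK0 htrivK).ne'⟩
  haveI : NeZero (transducerPeriod k δ) := ⟨(transducerPeriod_pos hk0 htriv).ne'⟩
  set M := transducerBase (digitRestrict (k ^ p) (powδ k p δ)) with hM
  set e := minImageEquivPow hk hp δ htriv with he
  obtain ⟨c, hc⟩ := hdp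
  have hcpos : 0 < c := by
    rcases Nat.eq_zero_or_pos c with rfl | h
    · rw [mul_zero] at hc; omega
    · exact h
  -- `k₀ ∣ c`
  have hk0c : transducerK0 hk δ htriv ∣ c := by
    have : transducerPeriod k δ * transducerK0 hk δ htriv ∣ transducerPeriod k δ * c := hc ▸ hkp
    exact Nat.dvd_of_mul_dvd_mul_left (transducerPeriod_pos hk0 htriv) this
  obtain ⟨c', hc'⟩ := hk0c
  -- thresholds
  obtain ⟨msK, hmsK⟩ := MinImage.exists_uniform_stab hK htrivK (δ := (digitRestrict (k ^ p) (powδ k p δ)))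
  obtain ⟨mrK, hmrK⟩ := M.exists_forall_exists_loop_eq hK0 htrivK
  have h1K : (1 : Equiv.Perm (Fin (minRank (digitRestrict (k ^ p) (powδ k p δ))))) ∈ M.pathOutputs (k ^ p) M 0 :=
    MinImage.mem_pathOutputs.2 ⟨[], by simp, by simp, M.next_nil, M.T_nil⟩
  -- the identity-loop residues of the power transducer vanish for large `ℓ`
  have hzero : ∀ ℓ : ℕ, max (max msK mrK) (MinImage.s0Level hk htriv (δ := δ)) ≤ ℓ →
      M.sVal hK htrivK M 1 (ℓ * transducerPeriod (k ^ p) (digitRestrict (k ^ p) (powδ k p δ))) = 0 := by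
    intro ℓ hℓ
    have hℓ1 : msK ≤ ℓ := le_of_max_le_left (le_of_max_le_left hℓ)
    have hℓ2 : mrK ≤ ℓ := le_of_max_le_right (le_of_max_le_left hℓ)
    have hℓ3 : MinImage.s0Level hk htriv (δ := δ) ≤ ℓ := le_of_max_le_right hℓ
    obtain ⟨W, hWd, hWl, hWn, hWT⟩ := hmrK ℓ hℓ2 1 (Subgroup.one_mem _)
    have hstab := hmsK M M 0 1 h1K ℓ hℓ1
    have hsv := MinImage.sVal_eq hK htrivK hstab hWd (by rw [hWl, ZMod.val_zero, zero_add]) hWn hWT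
    rw [ZMod.val_zero, zero_add] at hsv
    rw [hsv, ZMod.natCast_eq_zero_iff]
    refine (transducerDPrime_powK_dvd hk hp δ htriv hK ⟨c, hc⟩).trans ?_
    rw [← ZMod.natCast_eq_zero_iff, wordVal_powK hk1 hWd]
    -- the block word is an identity loop of `δ` at `e M` of length `p ℓ d_K = (c ℓ d_K) d`
    set w := (W.map (msbBlock k p)).flatten with hw
    have hloop : (e M).IsIdLoop w := (MinImage.isIdLoop_powK_iff hk hp δ htriv M hWd).1 ⟨hWn, hWT⟩
    have hwl : w.length = (c * (ℓ * transducerPeriod (k ^ p) (digitRestrict (k ^ p) (powδ k p δ)))) * transducerPeriod k δ := by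
      rw [hw, length_flatten_map_msbBlock hk1 hWd, hWl, hc]; ring
    have hℓ' : MinImage.s0Level hk htriv (δ := δ) ≤ c * (ℓ * transducerPeriod (k ^ p) (digitRestrict (k ^ p) (powδ k p δ))) :=
      hℓ3.trans (by nlinarith [transducerPeriod_pos hK0 htrivK])
    rw [(e M).natCast_wordVal_loop hk htriv (digits_flatten_map_msbBlock hk1 W) hwl hloop.1 hℓ',
      hloop.2, MinImage.s0_one, zero_add, hc', show transducerK0 hk δ htriv * c' *
        (ℓ * transducerPeriod (k ^ p) (digitRestrict (k ^ p) (powδ k p δ))) = (c' * (ℓ * transducerPeriod (k ^ p) (digitRestrict (k ^ p) (powδ k p δ)))) *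
        transducerK0 hk δ htriv by ring, mul_nsmul', transducerK0_nsmul_s0Slope, nsmul_zero]
  -- hence the common slope of the power transducer is `0`
  have hspec := (MinImage.exists_common_slope hK htrivK (δ := (digitRestrict (k ^ p) (powδ k p δ)))).choose_spec.choose_spec
  set mK := (MinImage.exists_common_slope hK htrivK (δ := (digitRestrict (k ^ p) (powδ k p δ)))).choose with hmK
  set aK := (MinImage.exists_common_slope hK htrivK (δ := (digitRestrict (k ^ p) (powδ k p δ)))).choose_spec.choose with haK
  set L := max mK (max (max msK mrK) (MinImage.s0Level hk htriv (δ := δ))) with hL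
  have e1 : L • aK = 0 := by
    rw [← hspec M L (le_max_left _ _)]; exact hzero L (le_max_right _ _)
  have e2 : (L + 1) • aK = 0 := by
    rw [← hspec M (L + 1) ((le_max_left _ _).trans (Nat.le_succ _))]
    exact hzero (L + 1) ((le_max_right _ _).trans (Nat.le_succ _))
  have haK0 : aK = 0 := by rw [succ_nsmul, e1, zero_add] at e2; exact e2
  rw [transducerK0, ← haK, haK0, addOrderOf_zero]

end K0Pow

end Literature.NumberTheory.LFunctions
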